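import Mathlib.RingTheory.KrullDimension.Basic
import Mathlib.RingTheory.RegularLocalRing.Defs
import Literature.AlgebraicGeometry.Resolution.QuadraticTransforms
import Literature.AlgebraicGeometry.Resolution.RsopMonomialIdeals
import HarnessLib

/-!
# Heinzer–Loper–Olberding–Schoutens–Toeniskoetter: a Shannon extension has a HULL PARAMETER
# (arXiv:1505.06445 = J. Algebra 474 (2017) 213–239, Proposition 3.8: some regular parameter `x` of some
# member `R_i` has `xR_{i+1} = 𝔪_iR_{i+1}` and `xS` primary for the maximal ideal `N` of `S = ⋃ R_i`)

Topic: `Literature/AlgebraicGeometry/Resolution`. NAMED FACT, sibling of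
`HeinzerEtAl2015NoetherianHullUFD` (`ShannonNoetherianHullUFD.lean`, Thm. 4.1 (1) UFD clause, which takes
such an `x` AS A HYPOTHESIS — this file supplies the printed EXISTENCE statement it consumes) and of
`HeinzerEtAl2015ShannonValuationRankTwo` (`ShannonValuationRankTwo.lean`). Filed for the cell
`res-hironaka`, rung L, slot W4.1, crux `Steer` `stmt-ResolutionOfSingularities-16345`: the support piece
`NearFarDichotomy` of res-L0-w41-idea-2's NSCᴹ line (Sketch-idea-2f, -2h §G5 «SUPPORT (in print) … HLOST
Prop. 3.8») is «point sequence exists ∧ hull parameter exists ∧ near-or-far»; the tree has the point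
sequence (`Theorems/FrobeniusClosingSteerSwitchingSetup`) and the hull vocabulary (`…SteerHullVocabulary`,
`IsHullParameter`), and the hull-parameter EXISTENCE is exactly this proposition (consumer:
`Theorems/FrobeniusClosingSteerNearFarDichotomy.lean`).

## What the source prints (arXiv:1505.06445; pages read 2026-08-27 on the held copy `paper:arxiv-1505.06445`,
## chunks p0007/p0008 — chunk ids, not necessarily PDF page numbers)

* **Setting 3.1** (chunk p0007), VERBATIM: «We make the following assumptions throughout the rest of the
  paper. (1) `(R, 𝔪)` is a regular local ring with quotient field `F` such that `dim R ≥ 2`. (2) `{(R_i, 𝔪_i)}`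
  is an infinite sequence of local quadratic transforms of regular local rings starting from `R_0 = R`. That
  is, for each `i > 0`, `R_i` is a local quadratic transform of `R_{i-1}`, so `R_i` is a regular local ring,
  `R_{i-1} ⊊ R_i`, and, by Remark (dim remark), `dim R_{i-1} ≥ dim R_i ≥ 2`. (3) `S = ⋃_{i=0}^∞ R_i` is the
  Shannon extension of `R` along `{R_i}` and `N = ⋃_{i=0}^∞ 𝔪_i` is the maximal ideal of `S`. (4) […]»
* **Proposition 3.8** (chunk p0008), VERBATIM: «Assuming Setting 3.1, there exists a regular parameter `x` in
  one of the `R_i`'s such that `xR_{i+1} = 𝔪_iR_{i+1}` and `xS` is an `N`-primary ideal of `S`.»  Printed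
  proof (same chunk, 12 lines): choose `i` beyond the finitely many order valuation rings that are essential
  prime divisors of `S` (Prop. 2.8: at most `dim R − 1` of them), let `x ∈ 𝔪_i` with `xR_{i+1} = 𝔪_iR_{i+1}`
  («Note that `𝔪_i ⊆ xS` and `xS ∩ R_i = 𝔪_i`»); a non-maximal prime `𝔮 ∋ x` would give a height-one prime
  `𝔭 ∋ x` of `S` with `𝔭 ∩ R_i = 𝔪_i` and `S_𝔭` an essential prime divisor of `R_i`, i.e. `S_𝔭 = R_i`,
  «contradicting the assumption that `dim R_i ≥ 2`. We conclude that `√(xS) = N`.»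

## Print placement of the form below (why it is WEAKER than print, never stronger)

Data inside one field `K` (the shape of the sibling `HeinzerEtAl2015NoetherianHullUFD`): `O` a valuation ring
of `K`; `R : ℕ → Subring K` with `R 0` a regular local ring dominated by `O`; every `R (i+1)` the quadratic
transform of `R i` ALONG `O` (`IsQuadraticTransformAlong`, Cutkosky §2.2 = the tree's notion; a local
quadratic transform in the sense of print by `IsQuadraticTransformAlong.isQuadraticTransform`); all members of
Krull dimension `≥ 2` (Setting 3.1 (2): then `R i ⊊ R (i+1)`, the sequence is infinite, every member is a
regular local ring dominated by `O` — `isRegularLocalRing_sequence`, `sequence_dominates` — and `S := ⨆ R i`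
is the Shannon extension of `R 0` along `O`, Setting 3.1 (3), with maximal ideal `N = {a ∈ S : v_O(a) < 1}`).
Conclusion, read inside `K`: there are `i`, an element `x ∈ K` which is a one-element part of a regular system
of parameters of `R i` («a regular parameter `x` in one of the `R_i`'s»; typed with the tree's `IsRsopPart` on
`Fin 1`, the `IsLocalRing (R i)` structure being supplied existentially, instance-free), such that
(a) every `y ∈ R i` with `v_O(y) < 1` satisfies `y / x ∈ R (i+1)` — i.e. `𝔪_i ⊆ xR_{i+1}`, which with
`x ∈ 𝔪_i` IS «`xR_{i+1} = 𝔪_iR_{i+1}`» (`𝔪_i = {y ∈ R i : v_O(y) < 1}` by domination); and (b) every `a ∈ S`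
with `v_O(a) < 1` has a power `a^m = s·x` with `s ∈ S` — i.e. `N ⊆ √(xS)`, which for `x ∈ N` in the local
ring `(S, N)` IS «`xS` is `N`-primary» (same rendering as the sibling fact's hypothesis, so the two compose
by `exact`).  Ambient field: print works in the quotient field `F` of `R`; every member, `S` and `x` lie in
`Frac(R 0) ⊆ K`, and along `O ∩ Frac(R 0)` the `R i` are the printed quadratic transforms, so the form below
is the printed statement read inside `K`.  NOT in print and NOT claimed: anything for a sequence with a
member of dimension `≤ 1` (there the transform is stationary and the statement is a triviality the consumer
proves for itself), or for sequences not taken along a dominating valuation ring.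

-- TODO(general form): none needed for Prop. 3.8 itself; Prop. 2.8 («`epd(S/R)` contains at most `dim R − 1`
-- order valuation rings»), Prop. 3.3 (`S_P` regular for non-maximal `P`) and Cor. 3.9 (S Noetherian ⟺ DVR)
-- are NOT typed here.

References: W. Heinzer, K. A. Loper, B. Olberding, H. Schoutens, M. Toeniskoetter, *Ideal theory of infinite
directed unions of local quadratic transforms*, J. Algebra 474 (2017) 213–239 (= arXiv:1505.06445),
Setting 3.1, Prop. 2.8, Prop. 3.8 [HeinzerEtAl2015]; S. D. Cutkosky, *Counterexamples to local
monomialization in positive characteristic*, Math. Ann. 362 (2015), §2.1–2.2 (the tree's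
`QuadraticTransforms.lean`) [Cutkosky2014]; D. Shannon, *Monoidal transforms of regular local rings*,
Amer. J. Math. 95 (1973) [Shannon1973].
-/

noncomputable section

namespace Literature.AlgebraicGeometry.Resolution

open IsLocalRing

universe u

/-- NAMED FACT — **Heinzer–Loper–Olberding–Schoutens–Toeniskoetter 2017, Proposition 3.8: a Shannon
extension along a dominating valuation ring has a HULL PARAMETER** (chunk p0008: «Assuming Setting 3.1, there
exists a regular parameter `x` in one of the `R_i`'s such that `xR_{i+1} = 𝔪_iR_{i+1}` and `xS` is an
`N`-primary ideal of `S`.», Setting 3.1 in chunk p0007).  Data, inside one field `K`: `O : ValuationSubring K`;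
`R : ℕ → Subring K` with `R 0` regular local, dominated by `O`, every member of Krull dimension `≥ 2`
(Setting 3.1), each `R (i+1)` the quadratic transform of `R i` ALONG `O` (`IsQuadraticTransformAlong`);
`S := ⨆ R i`.  Conclusion: for some `i` there is `x ∈ K`, a one-element part of a regular system of parameters
of `R i` (`IsRsopPart` on `Fin 1`, the local-ring structure of `R i` supplied existentially), with
(a) `y / x ∈ R (i+1)` for every `y ∈ R i` of `O`-value `< 1` («`xR_{i+1} = 𝔪_iR_{i+1}`») and (b) every `a ∈ S`
of `O`-value `< 1` has a power `a^m = s·x`, `s ∈ S` («`xS` is `N`-primary» — the very hypothesis of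
`HeinzerEtAl2015NoetherianHullUFD`).  The reduction of this form to the printed statement (and why it is
weaker) is the paragraph «Print placement» of the module docstring.  Users take
`(h : HeinzerEtAl2015HullParameterExists)`.
[cite: HeinzerEtAl2015, Prop. 3.8, Setting 3.1, Prop. 2.8] [cite: Cutkosky2014, §2.2] -/
def HeinzerEtAl2015HullParameterExists : Prop :=
  ∀ (K : Type u) [Field K] (O : ValuationSubring K) (R : ℕ → Subring K),
    IsRegularLocalRing (R 0) →
    (∀ i, (2 : WithBot ℕ∞) ≤ ringKrullDim (R i)) →
    SubringDominates (R 0) O.toSubring →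
    (∀ i, IsQuadraticTransformAlong O (R i) (R (i + 1))) →
    ∃ (i : ℕ) (x : K) (_ : IsLocalRing (R i)) (z : Fin 1 → R i), IsRsopPart z ∧ ((z 0 : R i) : K) = x ∧
      (∀ y : K, y ∈ R i → O.valuation y < 1 → y / x ∈ R (i + 1)) ∧
      (∀ a : K, a ∈ (⨆ i, R i : Subring K) → O.valuation a < 1 →
        ∃ (m : ℕ) (s : K), s ∈ (⨆ i, R i : Subring K) ∧ a ^ m = s * x)

end Literature.AlgebraicGeometry.Resolution

end
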